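import Summits.QuantumFields.QCD.Theorems.WilsonMobilityGapChiralMobilityGapAnchorCoreDefs
import Summits.QuantumFields.QCD.Theorems.WilsonMobilityGapChiralMobilityGapAnchorSandwich

/-!
# Crux `ChiralMobilityGap` (stmt-QuantumFields-17497) FROM THE FOUR NAMED NODES of line `Ideator3Sketch`
# — the conditional closer BY NAME, and the kill route for the chirality node

`chiralMobilityGap_of_anchorNodes : AnchorPionCeiling → AnchorFloorFinite → AnchorFloorChiral → AnchorSplit →
ChiralMobilityGap` is the composition §4 of the registered skeleton `Cruxes/ChiralMobilityGap/Lines/Ideator3Sketch.lean`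
(v8, sha f8fa2683) with its four `sorry`d stubs replaced by the named `@[conjecture]` nodes of
`…ChiralMobilityGapAnchorCoreDefs.lean`, over the LANDED transfer `chiralMobilityGap_of_anchorCore` (p138003), glue A
`stub_upperOfPionCeiling` (p140335) and glue B′ `stub_lowerWithOfFloorAndCeiling` (p140812): the crux is kernel-closed
modulo the four named conjectures and nothing else (the gate records a conditional result; the item stays open).

`not_anchorFloorChiral_of_uniformAxisCeiling` is the refutation route of the chirality node made formal: by the landed
sandwich tightness `ceilingRate_le_two_mul_floorRate` (p142602), a pion ceiling along ONE `N_f ∈ {2,3}` whose physical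
rate is bounded below UNIFORMLY in the renormalised mass `t` (a `t`-uniform pion gap of the anchored lattice theory,
i.e. "the anchor is NOT the chiral line") contradicts `AnchorFloorChiral`.
-/

noncomputable section

namespace Summit.QuantumFields.QCD.Theorems.ChiralMobilityGapAnchor

open scoped BigOperators Topology
open MeasureTheory Filter Set
open Literature.MathematicalPhysics.QuantumFieldTheory Literature.MathematicalPhysics.QuantumLattice
  Literature.Probability.LatticeModels
open Summit.QuantumFields.QCD.Theorems.MobilityGapNegative (bare fm ClauseI Upper Lower Sign Clauses
  norm_single_natCast)
open Summit.QuantumFields.QCD.Theorems.ChiralMobilityGapSketch (LowerWith VanishingChiralRate lower_iff)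

/-! ### §1 Small bookkeeping -/

/-- `N_f ∈ {2,3}` gives `2 ≤ N_f`. -/
theorem two_le_of_two_or_three {Nf : ℕ} (hNf : Nf = 2 ∨ Nf = 3) : 2 ≤ Nf := by
  rcases hNf with rfl | rfl <;> norm_num

/-- The time-axis site `n e₀` lies in `box 4 S` whenever `n ≤ S`. -/
theorem timeAxis_mem_box {n S : ℕ} (h : n ≤ S) : (Pi.single 0 (n : ℤ) : Site 4) ∈ box 4 S := by
  rw [mem_box]
  intro i
  by_cases hi : i = 0
  · subst hi
    simp only [Pi.single_eq_same]
    omega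
  · simp [Pi.single_eq_of_ne hi]

/-- A positive tuple with no two distinct components is the constant tuple at its value at `⟨0, _⟩`. -/
theorem eq_const_of_not_split {Nf : ℕ} (hNf : Nf = 2 ∨ Nf = 3) (m : Fin Nf → ℝ)
    (h : ¬ ∃ f g : Fin Nf, m f ≠ m g) :
    m = fun _ => m ⟨0, lt_of_lt_of_le two_pos (two_le_of_two_or_three hNf)⟩ := by
  funext f
  by_contra hne
  exact h ⟨f, _, hne⟩

/-! ### §2 The diagonal from nodes 1, 2a, 2b (glue A, glue B′) -/

/-- **The pion ceiling read along the time axis**, with a positive constant: under `AnchorPionCeiling`, for every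
`t > 0` there are `δ, C > 0` with `fm(2)(n e₀) ≤ C e^{-δ a_k n}` on every torus `S ≥ L_k`, `n ≤ S`, eventually in `k`
(node 1 at `v = n e₀ ∈ box 4 S`, `‖n e₀‖∞ = n`, `C ↦ max C 1`). -/
theorem axisCeiling_of_anchorPionCeiling (hP : AnchorPionCeiling) {Nf : ℕ} (hNf : Nf = 2 ∨ Nf = 3) (t : ℝ)
    (ht : 0 < t) :
    ∃ δ C : ℝ, 0 < δ ∧ 0 < C ∧ ∀ᶠ k in atTop, ∀ S : ℕ, (anchorReg Nf).L k ≤ S →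
      ∀ (f : Fin Nf) (n : ℕ), n ≤ S →
        fm Nf ((anchorReg Nf).β k) (bare (anchorReg Nf) (fun _ => t) k) S f (Pi.single 0 (n : ℤ)) 2 ≤
          C * Real.exp (-(δ * ((anchorReg Nf).a k * n))) := by
  obtain ⟨δ, C, hδ, hE⟩ := hP Nf hNf t ht
  refine ⟨δ, max C 1, hδ, lt_max_of_lt_right one_pos, ?_⟩
  filter_upwards [hE] with k hk S hS f n hn
  have h := hk S hS f (Pi.single 0 (n : ℤ)) (timeAxis_mem_box hn)
  rw [norm_single_natCast] at h
  exact h.trans (mul_le_mul_of_nonneg_right (le_max_left _ _) (Real.exp_pos _).le)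

/-- **(ii) on the diagonal** of the anchored witness under node 1: glue A (`stub_upperOfPionCeiling`, p140335). -/
theorem upper_diag_of_anchorPionCeiling (hP : AnchorPionCeiling) {Nf : ℕ} (hNf : Nf = 2 ∨ Nf = 3) (t : ℝ)
    (ht : 0 < t) : Upper (anchorReg Nf) (fun _ => t) :=
  stub_upperOfPionCeiling (two_le_of_two_or_three hNf) (anchorReg Nf) t (hP Nf hNf t ht)

/-- **(iii) with its rate on the diagonal from a floor at rate `μ`** under node 1: a first-moment floor at physical rate
`μ` at `(t,…,t)` and the axis ceiling give `LowerWith (anchorReg N_f) (t,…,t) (1/2) c₀ C₁ p` with `c₀ > 0` and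
`C₁ ≤ 3μ/2` (glue B′, `stub_lowerWithOfFloorAndCeiling`, p140812). -/
theorem lowerWith_of_floor_of_anchorPionCeiling (hP : AnchorPionCeiling) {Nf : ℕ} (hNf : Nf = 2 ∨ Nf = 3) {t : ℝ}
    (ht : 0 < t) {μ c q : ℝ} (hc : 0 < c)
    (hF : ∀ᶠ k in atTop, ∀ S : ℕ, (anchorReg Nf).L k ≤ S → ∀ (f : Fin Nf) (n : ℕ), n ≤ S →
      c * Real.exp (-(μ * ((anchorReg Nf).a k * n) + q * Real.log (n + 1))) ≤
        fm Nf ((anchorReg Nf).β k) (bare (anchorReg Nf) (fun _ => t) k) S f (Pi.single 0 (n : ℤ)) 1) :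
    ∃ c₀ C₁ p : ℝ, 0 < c₀ ∧ C₁ ≤ 3 * μ / 2 ∧ LowerWith (anchorReg Nf) (fun _ => t) (1 / 2) c₀ C₁ p := by
  obtain ⟨δ, C, hδ, hC, hE⟩ := axisCeiling_of_anchorPionCeiling hP hNf t ht
  exact ⟨c ^ (3 / 2 : ℝ) * C ^ (-(1 / 2 : ℝ)), (3 * μ - δ) / 2, 3 * q / 2,
    mul_pos (Real.rpow_pos_of_pos hc _) (Real.rpow_pos_of_pos hC _), by linarith,
    stub_lowerWithOfFloorAndCeiling (two_le_of_two_or_three hNf) (anchorReg Nf) t hc hC hF hE⟩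

/-- **(iii) on the diagonal** of the anchored witness under nodes 1 and 2a. -/
theorem lower_diag_of_anchorNodes (hP : AnchorPionCeiling) (hFl : AnchorFloorFinite) {Nf : ℕ}
    (hNf : Nf = 2 ∨ Nf = 3) (t : ℝ) (ht : 0 < t) : Lower (anchorReg Nf) (fun _ => t) := by
  obtain ⟨μ, c, q, hc, hF⟩ := hFl Nf hNf t ht
  obtain ⟨c₀, C₁, p, hc₀, -, hLW⟩ := lowerWith_of_floor_of_anchorPionCeiling hP hNf ht hc hF
  exact (lower_iff _ _).2 ⟨1 / 2, c₀, C₁, p, by norm_num, by norm_num, hc₀, hLW⟩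

/-- **Vanishing chiral rate** of the anchored witness under nodes 1 and 2b: at the `t` of node 2b for `ε/8` the
(iii)-rate satisfies `2C₁ ≤ 3ε/8 < ε/2 = sε`. -/
theorem vcr_of_anchorNodes (hP : AnchorPionCeiling) (hCh : AnchorFloorChiral) {Nf : ℕ} (hNf : Nf = 2 ∨ Nf = 3) :
    VanishingChiralRate (anchorReg Nf) := by
  intro ε hε
  obtain ⟨t, ht, c, q, hc, hF⟩ := hCh Nf hNf (ε / 8) (by linarith)
  obtain ⟨c₀, C₁, p, hc₀, hC₁, hLW⟩ := lowerWith_of_floor_of_anchorPionCeiling hP hNf ht hc hF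
  refine ⟨t, ht, 1 / 2, c₀, C₁, p, by norm_num, by norm_num, hc₀, ?_, hLW⟩
  linarith

/-! ### §3 Every positive tuple (node 3 off the diagonal) and the crux by name -/

/-- **(ii) for every positive tuple** along the anchored witness (diagonal: node 1 + glue A; split: node 3). -/
theorem upper_of_anchorNodes (hP : AnchorPionCeiling) (hSp : AnchorSplit) :
    ∀ Nf : ℕ, Nf = 2 ∨ Nf = 3 → ∀ m : Fin Nf → ℝ, (∀ f, 0 < m f) → Upper (anchorReg Nf) m := by
  intro Nf hNf m hm
  by_cases h : ∃ f g : Fin Nf, m f ≠ m g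
  · exact (hSp Nf hNf m hm h).1
  · rw [eq_const_of_not_split hNf m h]
    exact upper_diag_of_anchorPionCeiling hP hNf _ (hm _)

/-- **(iii) for every positive tuple** along the anchored witness (diagonal: nodes 1, 2a + glue B′; split: node 3). -/
theorem lower_of_anchorNodes (hP : AnchorPionCeiling) (hFl : AnchorFloorFinite) (hSp : AnchorSplit) :
    ∀ Nf : ℕ, Nf = 2 ∨ Nf = 3 → ∀ m : Fin Nf → ℝ, (∀ f, 0 < m f) → Lower (anchorReg Nf) m := by
  intro Nf hNf m hm
  by_cases h : ∃ f g : Fin Nf, m f ≠ m g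
  · exact (hSp Nf hNf m hm h).2
  · rw [eq_const_of_not_split hNf m h]
    exact lower_diag_of_anchorNodes hP hFl hNf _ (hm _)

/-- **THE CONDITIONAL CLOSER BY NAME: `ChiralMobilityGap` (stmt-QuantumFields-17497) from the four named open nodes of
line `Ideator3Sketch`** — witness `anchorReg N_f`, through the landed transfer `chiralMobilityGap_of_anchorCore`
(p138003; scalings, (i), (iv), the `N_f = 3` sign input, super-log volumes and the pin lemmas are landed for it).
This is the composition `ChiralMobilityGap_of` of the registered skeleton v8 with its stubs as hypotheses; the crux is
closed modulo exactly `AnchorPionCeiling`, `AnchorFloorFinite`, `AnchorFloorChiral`, `AnchorSplit`. -/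
theorem chiralMobilityGap_of_anchorNodes : AnchorPionCeiling → AnchorFloorFinite → AnchorFloorChiral → AnchorSplit → Summit.QuantumFields.QCD.Theses.WilsonMobilityGap.ChiralMobilityGap :=
  fun hP hFl hCh hSp =>
    chiralMobilityGap_of_anchorCore (upper_of_anchorNodes hP hSp) (lower_of_anchorNodes hP hFl hSp)
      fun _ hNf => vcr_of_anchorNodes hP hCh hNf

/-! ### §4 The kill route for the chirality node (sandwich tightness, p142602) -/

/-- **A `t`-uniform pion gap along the anchored witness refutes `AnchorFloorChiral`.**  If for ONE `N_f ∈ {2,3}` there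
is `δ₀ > 0` such that for EVERY renormalised mass `t > 0` the second moment along the time axis has a ceiling
`fm(2)(n e₀) ≤ C(t) e^{-δ₀ a_k n}` on every torus `S ≥ L_k`, `n ≤ S`, eventually in `k` (the pion mass of the anchored
lattice theory stays `≥ δ₀/2`-ish in physical units however light the renormalised quark mass — "the anchor is not
the chiral line"), then the chirality node fails: at `ε = δ₀/4` node 2b would give a first-moment floor at rate `δ₀/4`
at some `t`, and `ceilingRate_le_two_mul_floorRate` forces `δ₀ ≤ 2·(δ₀/4)`. -/
theorem not_anchorFloorChiral_of_uniformAxisCeiling {Nf : ℕ} (hNf : Nf = 2 ∨ Nf = 3) {δ₀ : ℝ} (hδ₀ : 0 < δ₀)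
    (hU : ∀ t : ℝ, 0 < t → ∃ C : ℝ, ∀ᶠ k in atTop, ∀ S : ℕ, (anchorReg Nf).L k ≤ S →
      ∀ (f : Fin Nf) (n : ℕ), n ≤ S →
        fm Nf ((anchorReg Nf).β k) (bare (anchorReg Nf) (fun _ => t) k) S f (Pi.single 0 (n : ℤ)) 2 ≤
          C * Real.exp (-(δ₀ * ((anchorReg Nf).a k * n)))) :
    ¬ AnchorFloorChiral := by
  intro hCh
  obtain ⟨t, ht, c, q, hc, hF⟩ := hCh Nf hNf (δ₀ / 4) (by linarith)
  obtain ⟨C, hC⟩ := hU t ht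
  have h := ceilingRate_le_two_mul_floorRate (two_le_of_two_or_three hNf) (anchorReg Nf) t hc hF hC
  linarith

end Summit.QuantumFields.QCD.Theorems.ChiralMobilityGapAnchor

end
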